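import Mathlib
import Literature.Probability.RandomPlanarGeometry.HexParafermion
import Literature.Probability.RandomPlanarGeometry.HexSAW

/-!
# Negative lemma for crux `HexTight` (stmt-CriticalPhenomena-5423): the renewal-gluing
inequality is false without `a ≠ b`

Crux-triage round 1 (triager 1). The shared `First lemma:` `RenewalGluing` of the idea cards
`continuation-value-reverse-holder` and `tip-renewal-complementarity`
(`Cruxes/HexTight/SketchIdeator1.lean`, reproduced VERBATIM below as `RenewalGluingAsTyped`, since
crux work files cannot be imported here) quantifies over ALL mid-edges `a b`. When `a = b` is an
edge straddling the cut between `Λ ∖ B` and `B`, the right-hand side `Σ_{γ : Λ, a → a} x_c^ℓ` is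
exactly `1` — in this formalisation a mid-edge walk `a → a` of positive length re-uses the half-edge
`a`, which `HexMidEdgeSAW.edges_nodup` forbids, so only the trivial walk survives, for EVERY `Λ`
(`verts_eq_nil_of_eq`) — while the left-hand side contains the trivial ⊗ trivial pair at the door
`a` (value `1`) PLUS every rooted polygon through `a` split at the cut.

Witness (`not_renewalGluingAsTyped`): `Λ` = the six faces of the central hexagon
`U0 – D0 – U2 – D1 – U1 – D2 – U0`, `B = {D1, U1, D2}`, `a = b = s(U0, D2)`:
LHS `≥ 1 + x_c^6 > 1 =` RHS.

Repair (what both cards actually use): add the hypothesis `a ≠ b`; then concatenation across the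
door is an injection into `HexMidEdgeSAW Λ a b` with lengths adding (vertex classes disjoint, the
door edge distinct from both edge lists, `a ∉` edges of the inner piece, `b ∉` edges of the outer
piece), and the inequality holds.
-/

noncomputable section

open scoped BigOperators
open Classical
open Literature.Probability.LatticeModels
open Literature.Probability.RandomPlanarGeometry.SAW

namespace Summit.CriticalPhenomena.SAWScalingLimit.Cruxes.HexTight.Negative

/-- VERBATIM copy of `Summit.CriticalPhenomena.SAWScalingLimit.Cruxes.HexTight.Sketch.RenewalGluing`
(`Cruxes/HexTight/SketchIdeator1.lean`, 2026-08-15): renewal gluing at a cut, for ALL `a b`. -/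
def RenewalGluingAsTyped : Prop :=
  ∀ (Λ B : Finset HexVertex) (a b : Sym2 HexVertex), B ⊆ Λ →
    (∑ v ∈ Λ \ B, ∑ u ∈ B,
        (if hexGraph.Adj v u then
          (∑ γ₁ : HexMidEdgeSAW (Λ \ B) a s(v, u), hexCriticalFugacity ^ γ₁.length) *
            (∑ γ₂ : HexMidEdgeSAW B s(v, u) b, hexCriticalFugacity ^ γ₂.length)
        else 0)) ≤
      ∑ γ : HexMidEdgeSAW Λ a b, hexCriticalFugacity ^ γ.length

/-- The repaired statement (hypothesis `a ≠ b` added) — recorded for provers; not proved here. -/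
def RenewalGluingNe : Prop :=
  ∀ (Λ B : Finset HexVertex) (a b : Sym2 HexVertex), B ⊆ Λ → a ≠ b →
    (∑ v ∈ Λ \ B, ∑ u ∈ B,
        (if hexGraph.Adj v u then
          (∑ γ₁ : HexMidEdgeSAW (Λ \ B) a s(v, u), hexCriticalFugacity ^ γ₁.length) *
            (∑ γ₂ : HexMidEdgeSAW B s(v, u) b, hexCriticalFugacity ^ γ₂.length)
        else 0)) ≤
      ∑ γ : HexMidEdgeSAW Λ a b, hexCriticalFugacity ^ γ.length

/-! ### The central hexagon (coordinates as in `Cruxes/HexTight/Disproof.lean` §3) -/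

/-- Up face of the cell `(0,0)`. -/
def U0 : HexVertex := (![0, 0], 0)
/-- Up face of the cell `(-1,0)`. -/
def U1 : HexVertex := (![-1, 0], 0)
/-- Up face of the cell `(0,-1)`. -/
def U2 : HexVertex := (![0, -1], 0)
/-- Down face of the cell `(0,-1)`. -/
def D0 : HexVertex := (![0, -1], 1)
/-- Down face of the cell `(-1,-1)`. -/
def D1 : HexVertex := (![-1, -1], 1)
/-- Down face of the cell `(-1,0)`. -/
def D2 : HexVertex := (![-1, 0], 1)

/-- Hexagon edge `U0 – D0`. -/
theorem adj_U0_D0 : hexGraph.Adj U0 D0 := by decide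
/-- Hexagon edge `D0 – U2`. -/
theorem adj_D0_U2 : hexGraph.Adj D0 U2 := by decide
/-- Hexagon edge `U2 – D1`. -/
theorem adj_U2_D1 : hexGraph.Adj U2 D1 := by decide
/-- Hexagon edge `D1 – U1`. -/
theorem adj_D1_U1 : hexGraph.Adj D1 U1 := by decide
/-- Hexagon edge `U1 – D2`. -/
theorem adj_U1_D2 : hexGraph.Adj U1 D2 := by decide
/-- Hexagon edge `U0 – D2` (the door `a = b`). -/
theorem adj_U0_D2 : hexGraph.Adj U0 D2 := by decide

/-- The outer half-hexagon `Λ ∖ B`. -/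
def P : Finset HexVertex := {U0, D0, U2}
/-- The "ball" `B`. -/
def B : Finset HexVertex := {D1, U1, D2}
/-- The whole hexagon `Λ`. -/
def L : Finset HexVertex := {U0, D0, U2, D1, U1, D2}

/-- `B ⊆ Λ`. -/
theorem B_subset_L : B ⊆ L := by decide
/-- `Λ ∖ B` is the outer half-hexagon. -/
theorem L_sdiff_B : L \ B = P := by decide

/-! ### In this formalisation every mid-edge walk `a → a` is trivial -/

/-- A mid-edge walk from `a` to `a` visits no vertex: otherwise its edge list
`a :: … ++ [a]` repeats `a`, contradicting `edges_nodup`. (No boundary hypothesis needed.) -/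
theorem verts_eq_nil_of_eq {Λ : Finset HexVertex} {a : Sym2 HexVertex}
    (γ : HexMidEdgeSAW Λ a a) : γ.verts = [] := by
  by_contra h
  have hnd := γ.edges_nodup h
  rw [List.cons_append, List.nodup_cons] at hnd
  exact hnd.1 (List.mem_append_right _ (List.mem_singleton_self a))

/-- Hence `Σ_{γ : Λ, a → a} x_c^{ℓ(γ)} = 1` as soon as `a` is a mid-edge of the domain. -/
theorem sum_self_eq_one {Λ : Finset HexVertex} {a : Sym2 HexVertex}
    (ha : a ∈ hexDomainMidEdges Λ) :
    (∑ γ : HexMidEdgeSAW Λ a a, hexCriticalFugacity ^ γ.length) = 1 := by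
  letI : Unique (HexMidEdgeSAW Λ a a) :=
    ⟨⟨HexMidEdgeSAW.trivial ha⟩, fun γ => HexMidEdgeSAW.ext (verts_eq_nil_of_eq γ)⟩
  rw [Fintype.sum_unique]
  show hexCriticalFugacity ^ (HexMidEdgeSAW.trivial ha).length = 1
  simp

/-! ### The explicit walks -/

/-- The door `s(U0,D2)` is a mid-edge of `P`. -/
theorem mem_midEdges_P : s(U0, D2) ∈ hexDomainMidEdges P := by
  refine ⟨(SimpleGraph.mem_edgeSet hexGraph).2 adj_U0_D2, U0, Sym2.mem_mk_left _ _, ?_⟩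
  simp [P]

/-- The door `s(U0,D2)` is a mid-edge of `B`. -/
theorem mem_midEdges_B : s(U0, D2) ∈ hexDomainMidEdges B := by
  refine ⟨(SimpleGraph.mem_edgeSet hexGraph).2 adj_U0_D2, D2, Sym2.mem_mk_right _ _, ?_⟩
  simp [B]

/-- The door `s(U0,D2)` is a mid-edge of `Λ`. -/
theorem mem_midEdges_L : s(U0, D2) ∈ hexDomainMidEdges L := by
  refine ⟨(SimpleGraph.mem_edgeSet hexGraph).2 adj_U0_D2, U0, Sym2.mem_mk_left _ _, ?_⟩
  simp [L]

/-- The second door `s(U2,D1)` is a mid-edge of `B`. -/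
theorem door_mem_midEdges_B : s(U2, D1) ∈ hexDomainMidEdges B := by
  refine ⟨(SimpleGraph.mem_edgeSet hexGraph).2 adj_U2_D1, D1, Sym2.mem_mk_right _ _, ?_⟩
  simp [B]

/-- The outer arc `mid(U0,D2) → U0 → D0 → U2 → mid(U2,D1)` of `P`. -/
def γout : HexMidEdgeSAW P s(U0, D2) s(U2, D1) where
  verts := [U0, D0, U2]
  subset := by decide
  nodup := by decide
  isChain := by decide
  head_mem := by
    intro v hv
    simp at hv
    subst hv
    exact Sym2.mem_mk_left _ _
  getLast_mem := by
    intro v hv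
    simp at hv
    subst hv
    exact Sym2.mem_mk_left _ _
  eq_of_nil := fun h => absurd h (List.cons_ne_nil _ _)
  edges_nodup := fun _ => by decide
  fst_mem := mem_midEdges_P

/-- The inner arc `mid(U2,D1) → D1 → U1 → D2 → mid(U0,D2)` of `B`. -/
def γin : HexMidEdgeSAW B s(U2, D1) s(U0, D2) where
  verts := [D1, U1, D2]
  subset := by decide
  nodup := by decide
  isChain := by decide
  head_mem := by
    intro v hv
    simp at hv
    subst hv
    exact Sym2.mem_mk_right _ _
  getLast_mem := by
    intro v hv
    simp at hv
    subst hv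
    exact Sym2.mem_mk_right _ _
  eq_of_nil := fun h => absurd h (List.cons_ne_nil _ _)
  edges_nodup := fun _ => by decide
  fst_mem := door_mem_midEdges_B

/-- `γout` visits three vertices. -/
theorem length_γout : γout.length = 3 := rfl
/-- `γin` visits three vertices. -/
theorem length_γin : γin.length = 3 := rfl

/-! ### The refutation -/

/-- The summand of the left-hand side at `Λ ∖ B = P`, `a = b = s(U0,D2)`. -/
def term (v u : HexVertex) : ℝ :=
  if hexGraph.Adj v u then
    (∑ γ₁ : HexMidEdgeSAW P s(U0, D2) s(v, u), hexCriticalFugacity ^ γ₁.length) *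
      (∑ γ₂ : HexMidEdgeSAW B s(v, u) s(U0, D2), hexCriticalFugacity ^ γ₂.length)
  else 0

/-- Every summand is nonnegative. -/
theorem term_nonneg (v u : HexVertex) : 0 ≤ term v u := by
  have hx : 0 ≤ hexCriticalFugacity := hexCriticalFugacity_pos_lt_one.1.le
  unfold term
  split_ifs
  · exact mul_nonneg (Finset.sum_nonneg fun _ _ => pow_nonneg hx _)
      (Finset.sum_nonneg fun _ _ => pow_nonneg hx _)
  · exact le_rfl

/-- The door `a` itself contributes the trivial ⊗ trivial pair: `term U0 D2 ≥ 1`. -/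
theorem one_le_term_U0_D2 : 1 ≤ term U0 D2 := by
  unfold term
  rw [if_pos adj_U0_D2]
  have h1 : (1 : ℝ) ≤
      ∑ γ₁ : HexMidEdgeSAW P s(U0, D2) s(U0, D2), hexCriticalFugacity ^ γ₁.length := by
    rw [sum_self_eq_one mem_midEdges_P]
  have h2 : (1 : ℝ) ≤
      ∑ γ₂ : HexMidEdgeSAW B s(U0, D2) s(U0, D2), hexCriticalFugacity ^ γ₂.length := by
    rw [sum_self_eq_one mem_midEdges_B]
  nlinarith

/-- The other door contributes the hexagon polygon: `term U2 D1 ≥ x_c ^ 6`. -/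
theorem pow_le_term_U2_D1 : hexCriticalFugacity ^ 6 ≤ term U2 D1 := by
  unfold term
  rw [if_pos adj_U2_D1]
  have hx : 0 ≤ hexCriticalFugacity := hexCriticalFugacity_pos_lt_one.1.le
  have h1 : hexCriticalFugacity ^ 3 ≤
      ∑ γ₁ : HexMidEdgeSAW P s(U0, D2) s(U2, D1), hexCriticalFugacity ^ γ₁.length := by
    have := Finset.single_le_sum (s := Finset.univ)
      (f := fun γ₁ : HexMidEdgeSAW P s(U0, D2) s(U2, D1) => hexCriticalFugacity ^ γ₁.length)
      (fun _ _ => by positivity) (Finset.mem_univ γout)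
    simpa [length_γout] using this
  have h2 : hexCriticalFugacity ^ 3 ≤
      ∑ γ₂ : HexMidEdgeSAW B s(U2, D1) s(U0, D2), hexCriticalFugacity ^ γ₂.length := by
    have := Finset.single_le_sum (s := Finset.univ)
      (f := fun γ₂ : HexMidEdgeSAW B s(U2, D1) s(U0, D2) => hexCriticalFugacity ^ γ₂.length)
      (fun _ _ => by positivity) (Finset.mem_univ γin)
    simpa [length_γin] using this
  calc hexCriticalFugacity ^ 6 = hexCriticalFugacity ^ 3 * hexCriticalFugacity ^ 3 := by ring
    _ ≤ _ := mul_le_mul h1 h2 (by positivity) (le_trans (by positivity) h1)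

/-- **The renewal-gluing inequality is false as typed** (degenerate case `a = b`): any proof of
the cards' renewal step must use `a ≠ b`. [folklore] -/
theorem not_renewalGluingAsTyped : ¬ RenewalGluingAsTyped := by
  intro h
  have hmain := h L B s(U0, D2) s(U0, D2) B_subset_L
  rw [L_sdiff_B, sum_self_eq_one mem_midEdges_L] at hmain
  change (∑ v ∈ P, ∑ u ∈ B, term v u) ≤ 1 at hmain
  have hprod : (∑ v ∈ P, ∑ u ∈ B, term v u) = ∑ x ∈ P ×ˢ B, term x.1 x.2 :=
    (Finset.sum_product' P B term).symm
  have hsub : ({(U0, D2), (U2, D1)} : Finset (HexVertex × HexVertex)) ⊆ P ×ˢ B := by decide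
  have hne : (U0, D2) ≠ (U2, D1) := by decide
  have hlow : term U0 D2 + term U2 D1 ≤ ∑ x ∈ P ×ˢ B, term x.1 x.2 := by
    have := Finset.sum_le_sum_of_subset_of_nonneg hsub
      (f := fun x : HexVertex × HexVertex => term x.1 x.2)
      (fun x _ _ => term_nonneg x.1 x.2)
    rwa [Finset.sum_pair hne] at this
  have hpos : 0 < hexCriticalFugacity ^ 6 := pow_pos hexCriticalFugacity_pos_lt_one.1 6
  linarith [one_le_term_U0_D2, pow_le_term_U2_D1]

end Summit.CriticalPhenomena.SAWScalingLimit.Cruxes.HexTight.Negative
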